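import Summits.BirchSwinnertonDyer.Rank1Residual.Additive.StrictSignedSelmer
import Summits.BirchSwinnertonDyer.Rank1Residual.Additive.SubSelmerControlZero
import Literature.NumberTheory.EllipticCurves.IwasawaSelmerDualProofs
import HarnessLib

/-!
# The dual `X^{ε,str}(E/K_∞)` EXISTS as a `Λ`-module, is a Pontryagin-dual pair for `conj_γ − 1`,
# and the bottom layer of the strict signed structure is bounded by `f(0)` (cell `b2b-bsdres`, team
# n1011, r = 1 strand, seat p17 GEN 3; row T-O7ss-P13 FILE 2b — sequel of `StrictSignedSelmer.lean`
# (FILE 2a, the structure) over `SubSelmerControlZero.lean` (FILE 1, the generic chain))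

HONEST FRAMING (cell `b2b-bsdres`, run/shared/lean/b2b/bsd-rank1-residual/, verbatim in every
file): the goal of the cell is to DELETE the COMBINATION-SHAPED residual classes of the
Birch–Swinnerton-Dyer formula for ALL analytic-rank `≤ 1` elliptic curves over `ℚ` — "full BSD
formula for every rank `≤ 1` curve in class `C`" assembled STRICTLY from published theorems — so
that the rank-`≤ 1` remainder becomes exactly the CONSTRUCTION-SHAPED classes, which are TYPED
(missing-input `Prop`s), NOT attempted. This is not "finishing BSD". Team n1011: prove what is
provable now; shrink each hard class to its core with data; no claim beyond stated classes; research
routes; census output = EVIDENCE / conjecture items, never a Literature fact; RESIDUAL-MAP marks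
change only by signed lines. O7-ss stays OPEN, X4 CONSTRUCTION-SHAPED; nothing here is booked; no
label moves. ONE definition (`conjStrictSignedSelmerInfty`, the restricted conjugation) and ONE
construction (`strictSignedSelmerDualData`, the dual as a datum); theorems otherwise; no named
Literature fact; `#print axioms` standard. Word for word the tree's
`Kobayashi2003/SignedSelmerDualExistsProofs.lean` and additive-p4's `SignedSelmerControlZero.lean` §2
with `signedSelmerInfty ↦ strictSignedSelmerInfty`.

## Contents

* §1 `conjStrictSignedSelmerInfty W κ E ε γ` — `conj_γ` as an endomorphism of `Sel^{ε,str}(E/K_∞)`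
  (`conjH1_mem_strictSignedSelmerInfty`); powers; `(p, conj_γ − 1)` locally nilpotent for a
  topological generator (`isLocNil_conjStrictSignedSelmerInfty_sub_one`, from the tree's statements
  (P) `exists_pow_smul_subgroupH1_ker_eq_zero` and (A2) `exists_conjH1_pow_prime_pow_eq` about ALL of
  `H¹(K_∞, E[p^∞])`).
* §2 EXISTENCE: `strictSignedSelmerDualData W κ E ε hγ : StrictSignedSelmerDualData W κ E γ ε` —
  `X = Hom(Sel^{ε,str}_∞, ℚ/ℤ)` with the `Λ`-structure `IsLocNil.module` (`T = γ − 1`); so every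
  statement "`∀ D : StrictSignedSelmerDualData …`" (the typed readings (R1)/(R2) of FILE 4) is
  NON-VACUOUS. Every datum is a dual pair (`isDualPair`).
* §3 THE BOTTOM-LAYER BOUND (`StrictSignedControlZero.finite_and_padicValNat_card_layer_zero_le`):
  for a datum `D` with `X^{ε,str}` finitely generated torsion, `char = (f)`, `f(0) ≠ 0`, no
  non-trivial finite `Λ`-submodule, and `E(K_∞)[p^∞] = 0`: `Sel^{ε,str}(E/K_0)` is finite and
  **`ord_p #Sel^{ε,str}(E/K_0) ≤ ord_p f(0)`** — FILE 1's generic chain at `S_∞ = Sel^{ε,str}_∞`,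
  `S₀ = Sel^{ε,str}(E/K_0)`. For `ε = −1`, `K = ℚ` the bottom layer is the `p`-STRICT Selmer group
  (FILE 3), which turns this into the inequality of cc-typer-6's typed input
  `QuadraticBranchOddStrictSelmerBoundAt` (FILE 4, modulo the two readings).

References: [Kobayashi2003] S. Kobayashi, Invent. Math. 152 (2003), §2 p. 4, Def. 2.1 (p. 5),
Lemma 9.1 (p. 25); [GreenbergLNM1716] R. Greenberg, LNM 1716 (1999), §1 (p. 60), §3 Lemma 3.1
(p. 86), §4 Lemma 4.2 (p. 102).
-/

noncomputable section

open scoped Classical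

universe u

namespace Summit.BirchSwinnertonDyer.Rank1Residual.Additive

open WeierstrassCurve Literature.NumberTheory.EllipticCurves Literature.NumberTheory.GaloisRepresentations
  Literature.NumberTheory.EllipticCurves.IwasawaAlgebra Literature.NumberTheory.EllipticCurves.IwasawaDual
  Literature.NumberTheory.EllipticCurves.Kobayashi2003 ZpExtension

variable {K : Type u} [Field K] [NumberField K] (W : WeierstrassCurve K) {p : ℕ} [Fact p.Prime]
  (κ : ZpExtension K p) (E : Type u) [Field E] [Algebra K E] (ε : ℤˣ)

/-! ## §1 The conjugation endomorphism of `Sel^{ε,str}(E/K_∞)` and local nilpotence -/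

/-- `conj_γ` restricted to an endomorphism of `Sel^{ε,str}(E/K_∞)` (it preserves the strict signed
Selmer group by `conjH1_mem_strictSignedSelmerInfty`) — the action through which `Λ` acts on the
Pontryagin dual. [cite: Kobayashi2003, Def. 2.1 (p. 5)] -/
def conjStrictSignedSelmerInfty (γ : Field.absoluteGaloisGroup K) :
    AddMonoid.End (strictSignedSelmerInfty W κ E ε) :=
  ((W.conjH1 p κ.kerSubgroup γ).restrict (strictSignedSelmerInfty W κ E ε)).codRestrict
    (strictSignedSelmerInfty W κ E ε) fun s ↦ conjH1_mem_strictSignedSelmerInfty W κ E ε γ s.2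

/-- Unfolding `conjStrictSignedSelmerInfty` (definitional). [cite: Kobayashi2003, Def. 2.1 (p. 5)] -/
@[simp]
theorem coe_conjStrictSignedSelmerInfty_apply (γ : Field.absoluteGaloisGroup K)
    (s : strictSignedSelmerInfty W κ E ε) :
    ((conjStrictSignedSelmerInfty W κ E ε γ s : strictSignedSelmerInfty W κ E ε) :
        W.subgroupH1 p κ.kerSubgroup) = W.conjH1 p κ.kerSubgroup γ s :=
  rfl

/-- `conj_γ − 1` acts on underlying classes as `conj_γ s − s` (the hypothesis `hψ` of FILE 1's
`SubSelmerControlZero.finite_and_padicValNat_card_le`). [cite: Kobayashi2003, Def. 2.1 (p. 5)] -/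
theorem coe_conjStrictSignedSelmerInfty_sub_one_apply (γ : Field.absoluteGaloisGroup K)
    (s : strictSignedSelmerInfty W κ E ε) :
    (((conjStrictSignedSelmerInfty W κ E ε γ - 1) s : strictSignedSelmerInfty W κ E ε) :
        W.subgroupH1 p κ.kerSubgroup) = W.conjH1 p κ.kerSubgroup γ s - s := by
  rw [IwasawaDual.End_sub_apply, AddMonoid.End.one_apply, AddSubgroupClass.coe_sub,
    coe_conjStrictSignedSelmerInfty_apply]

/-- Powers of the restriction are restrictions of `conj_{γ^m}` (`conjH1_one_holds`,
`conjH1_mul_holds`). [cite: Kobayashi2003, Def. 2.1 (p. 5)] -/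
theorem coe_conjStrictSignedSelmerInfty_pow_apply (γ : Field.absoluteGaloisGroup K) (m : ℕ)
    (s : strictSignedSelmerInfty W κ E ε) :
    ((((conjStrictSignedSelmerInfty W κ E ε γ) ^ m) s : strictSignedSelmerInfty W κ E ε) :
        W.subgroupH1 p κ.kerSubgroup) = W.conjH1 p κ.kerSubgroup (γ ^ m) s := by
  induction m generalizing s with
  | zero => rw [pow_zero, pow_zero, AddMonoid.End.one_apply, W.conjH1_one_holds p κ.kerSubgroup,
      AddMonoidHom.id_apply]
  | succ m ih =>
    rw [pow_succ, AddMonoid.End.coe_mul, Function.comp_apply, ih, coe_conjStrictSignedSelmerInfty_apply,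
      pow_succ, W.conjH1_mul_holds p κ.kerSubgroup, AddMonoidHom.comp_apply]

/-- **`Sel^{ε,str}(E/K_∞)` is `p`-primary and `T = γ − 1` is locally nilpotent on it** (the
hypotheses `IwasawaDual.IsLocNil` of the generic `Λ`-action), for `γ` a topological generator: (P)
`exists_pow_smul_subgroupH1_ker_eq_zero` and (A2) `exists_conjH1_pow_prime_pow_eq` (statements about
all of `H¹(K_∞, E[p^∞])`) with `IwasawaDual.pow_mul_prime_pow_apply_eq_zero` — word for word
`isLocNil_conjSignedSelmerInfty_sub_one`. [cite: GreenbergLNM1716, §1 (p. 60)] -/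
theorem isLocNil_conjStrictSignedSelmerInfty_sub_one {γ : Field.absoluteGaloisGroup K}
    (hγ : κ.IsTopGenerator γ) :
    IwasawaDual.IsLocNil p (conjStrictSignedSelmerInfty W κ E ε γ - 1) := by
  have htor : ∀ s : strictSignedSelmerInfty W κ E ε, ∃ k : ℕ, p ^ k • s = 0 := fun s ↦ by
    obtain ⟨k, hk⟩ := W.exists_pow_smul_subgroupH1_ker_eq_zero κ (s : W.subgroupH1 p κ.kerSubgroup)
    exact ⟨k, Subtype.ext (by rw [AddSubgroupClass.coe_nsmul]; exact hk)⟩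
  refine ⟨htor, fun s ↦ ?_⟩
  obtain ⟨a, ha⟩ := W.exists_conjH1_pow_prime_pow_eq κ hγ (s : W.subgroupH1 p κ.kerSubgroup)
  obtain ⟨k, hk⟩ := htor s
  have hφ : ((conjStrictSignedSelmerInfty W κ E ε γ) ^ p ^ a) s = s :=
    Subtype.ext (by rw [coe_conjStrictSignedSelmerInfty_pow_apply]; exact ha)
  exact ⟨k * p ^ a, IwasawaDual.pow_mul_prime_pow_apply_eq_zero (Fact.out : p.Prime) _ a hφ hk⟩

/-! ## §2 Existence of the dual datum; every datum is a dual pair -/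

/-- **The Iwasawa module `X^{ε,str}(E/K_∞) = Hom(Sel^{ε,str}(E/K_∞), ℚ/ℤ)` with its `Λ`-module
structure** (`T = γ − 1`, constants through `ℤ_p → ℤ/pᵏ`) packaged as a
`StrictSignedSelmerDualData W κ E γ ε`: `X = (Sel^{ε,str}_∞ →+ AddCircle 1)`, `toDual = id`, module
structure `IsLocNil.module` — word for word the tree's `signedSelmerDualData`.
[cite: GreenbergLNM1716, §1 (p. 60)] [cite: Kobayashi2003, Def. 2.1 (p. 5)] -/
def strictSignedSelmerDualData {γ : Field.absoluteGaloisGroup K} (hγ : κ.IsTopGenerator γ) :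
    StrictSignedSelmerDualData W κ E γ ε :=
  { X := strictSignedSelmerInfty W κ E ε →+ AddCircle (1 : ℚ)
    module := (isLocNil_conjStrictSignedSelmerInfty_sub_one W κ E ε hγ).module
    conj_mem := fun s hs ↦ conjH1_mem_strictSignedSelmerInfty W κ E ε γ hs
    toDual := AddMonoidHom.id _
    bijective := Function.bijective_id
    toDual_T_smul := fun x s ↦ by
      show (isLocNil_conjStrictSignedSelmerInfty_sub_one W κ E ε hγ).smulFun PowerSeries.X x s =
        x _ - x s
      rw [(isLocNil_conjStrictSignedSelmerInfty_sub_one W κ E ε hγ).smulFun_X_apply,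
        IwasawaDual.End_sub_apply, AddMonoid.End.one_apply, map_sub]
      rfl
    toDual_C_smul := fun c x s k hk ↦ by
      show (isLocNil_conjStrictSignedSelmerInfty_sub_one W κ E ε hγ).smulFun (PowerSeries.C c) x s = _
      exact (isLocNil_conjStrictSignedSelmerInfty_sub_one W κ E ε hγ).smulFun_C_apply c x hk }

/-- **Existence**: for `γ` a topological generator of `Gal(K_∞/K)` the Pontryagin dual of
`Sel^{ε,str}(E/K_∞)` carries a `Λ`-module structure with `T = γ − 1`, i.e.
`StrictSignedSelmerDualData W κ E γ ε` is inhabited — NON-VACUITY of every statement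
"`∀ D : StrictSignedSelmerDualData W κ E γ ε, …`". [cite: GreenbergLNM1716, §1 (p. 60)] -/
theorem nonempty_strictSignedSelmerDualData {γ : Field.absoluteGaloisGroup K}
    (hγ : κ.IsTopGenerator γ) : Nonempty (StrictSignedSelmerDualData W κ E γ ε) :=
  ⟨strictSignedSelmerDualData W κ E ε hγ⟩

variable {W κ E ε}

namespace StrictSignedControlZero

/-- Every strict signed dual datum `D : StrictSignedSelmerDualData W κ E γ ε` is a dual pair for
`ψ = conj_γ − 1` on `Sel^{ε,str}(E/K_∞)`: `toDual_T_smul`, `toDual_C_smul`, and local nilpotence for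
a topological generator `γ` — word for word additive-p4's `SignedControlZero.isDualPair`.
[cite: GreenbergLNM1716, §1 (p. 60)] -/
theorem isDualPair {γ : Field.absoluteGaloisGroup K} (D : StrictSignedSelmerDualData W κ E γ ε)
    (hγ : κ.IsTopGenerator γ) :
    IwasawaDual.IsDualPair p (conjStrictSignedSelmerInfty W κ E ε γ - 1) D.toDual where
  bijective := D.bijective
  T_smul x s := by
    rw [D.toDual_T_smul, IwasawaDual.End_sub_apply, AddMonoid.End.one_apply, map_sub]
    rfl
  C_smul c x s k hk := D.toDual_C_smul c x s k hk
  locNil := isLocNil_conjStrictSignedSelmerInfty_sub_one W κ E ε hγ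

/-- Membership in `(Sel^{ε,str}_∞)^γ = ker(conj_γ − 1)`: `s` is fixed by `conj_γ`.
[cite: Kobayashi2003, Def. 2.1 (p. 5)] -/
theorem mem_endInvariants_conjStrictSignedSelmerInfty_iff {γ : Field.absoluteGaloisGroup K}
    (s : strictSignedSelmerInfty W κ E ε) :
    s ∈ endInvariants (conjStrictSignedSelmerInfty W κ E ε γ - 1) ↔
      W.conjH1 p κ.kerSubgroup γ (s : W.subgroupH1 p κ.kerSubgroup) = s := by
  rw [mem_endInvariants_iff, IwasawaDual.End_sub_apply, AddMonoid.End.one_apply, sub_eq_zero,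
    ← coe_conjStrictSignedSelmerInfty_apply]
  exact ⟨fun h ↦ congrArg
      (fun z : strictSignedSelmerInfty W κ E ε ↦ (z : W.subgroupH1 p κ.kerSubgroup)) h,
    fun h ↦ Subtype.ext h⟩

/-! ## §3 The bottom layer `Sel^{ε,str}(E/K_0)` is bounded by `f(0)` -/

/-- **The strict signed bottom-layer inequality.** Let `E/K` be an elliptic curve over a number
field, `κ` a `ℤ_p`-extension with topological generator `γ`, `ε` a sign, and `D` a Pontryagin-dual
datum of the STRICT signed Selmer group `Sel^{ε,str}(E/K_∞)` (Kobayashi's Def. 2.1 with the `m = −1`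
clause, in `W`-coordinates) whose module `X^{ε,str}` is finitely generated and `Λ`-torsion with
`char(X^{ε,str}) = (f)`. ASSUME `f(0) ≠ 0`, `E(K_∞)[p^∞] = 0`, and that `X^{ε,str}` has no non-trivial
finite `Λ`-submodule. THEN `Sel^{ε,str}(E/K_0)` is finite and
**`ord_p #Sel^{ε,str}(E/K_0) ≤ ord_p f(0)`** — FILE 1's `SubSelmerControlZero.finite_and_padicValNat_
card_le` at `S_∞ = Sel^{ε,str}_∞`, `S₀ = Sel^{ε,str}(E/K_0)` (`map_layerToInfty_strictSignedSelmerLayer_le`).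
For `ε = −1`, `K = ℚ`: `Sel^{−,str}(E/ℚ_0)` is the `p`-STRICT Selmer group (FILE 3), and with
Kobayashi Thm. 4.1 (odd `η`, `n = 0`) + Kitajima–Otsuki (sign `−`) read on `D` this is the bound of
cc-typer-6's `QuadraticBranchOddStrictSelmerBoundAt` (FILE 4).
[cite: Kobayashi2003, Lemma 9.1 (p. 25), §2 (p. 4)] [cite: GreenbergLNM1716, §4 Lemma 4.2 (p. 102)] -/
theorem finite_and_padicValNat_card_layer_zero_le {γ : Field.absoluteGaloisGroup K}
    (hγ : κ.IsTopGenerator γ) (D : StrictSignedSelmerDualData W κ E γ ε)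
    [Module.Finite (IwasawaAlgebra p) D.X] (hX : Module.IsTorsion (IwasawaAlgebra p) D.X)
    (hB : FixedPoints.addSubgroup κ.kerSubgroup (W.geomPrimaryTorsion p) = ⊥)
    (hnf : ∀ N : Submodule (IwasawaAlgebra p) D.X, Finite N → N = ⊥)
    {f : IwasawaAlgebra p} (hf : D.charIdeal = Ideal.span {f})
    (h0 : PowerSeries.constantCoeff f ≠ 0) :
    Finite (strictSignedSelmerLayer W κ E ε 0) ∧
      (padicValNat p (Nat.card (strictSignedSelmerLayer W κ E ε 0)) : ℤ) ≤
        ((PowerSeries.constantCoeff f : ℤ_[p]) : ℚ_[p]).valuation :=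
  SubSelmerControlZero.finite_and_padicValNat_card_le W hγ hB
    (coe_conjStrictSignedSelmerInfty_sub_one_apply W κ E ε γ) (isDualPair D hγ) hX hnf hf h0
    (strictSignedSelmerLayer W κ E ε 0) (map_layerToInfty_strictSignedSelmerLayer_le W κ E ε 0)

end StrictSignedControlZero

end Summit.BirchSwinnertonDyer.Rank1Residual.Additive

end
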